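import Literature.NumberTheory.EllipticCurves.NonsplitNode
import Literature.NumberTheory.EllipticCurves.TateModuleComparisonProofs
import Literature.NumberTheory.EllipticCurves.TateModuleFinite
import Literature.NumberTheory.EllipticCurves.TateModuleContinuityProofs
import Literature.NumberTheory.GaloisRepresentations.GaloisRep
import Literature.NumberTheory.GaloisRepresentations.IntegralGaloisAction
import HarnessLib

/-!
# The `ℓ`-adic Tate module of the nodal cubic `y² = x³ + a x²`: `V_ℓ(E_ns) ≅ ℚ_ℓ(1) ⊗ χ_a`

Topic `EllipticCurves`; sequel of `NonsplitNode` (Silverman, *AEC*, Prop. III.2.5(a) and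
Exercise 3.5: `E_ns(F̄) ≅ F̄ˣ` with `Γ_F` acting through the quadratic character `χ_a` of
`F(√a)/F`, `WeierstrassCurve.nodalCubic.nodeMap` and its twist formulas) and of the Tate-module
files (`TateModule`, `TateModuleFinite`, `TateModuleComparisonProofs`,
`TateModuleContinuityProofs`).  For the node `W_a = nodalCubic a` with `2a ≠ 0`:

* `module_finite_tateModule`, `module_finite_rationalTateModule`, `finrank_tateModule_eq_one`,
  `finrank_rationalTateModule_eq_one` — `T_ℓ(E_ns(F̄)) ≅ ℤ_ℓ` and `V_ℓ(E_ns(F̄)) ≅ ℚ_ℓ` for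
  `ℓ ≠ char F` (transport of `finrank_tateModule_additive_units`, Silverman *ATAEC* p. 359
  "`V_ℓ(k̄^*) ≅ ℚ_ℓ`", along the node map);
* `continuous_rationalTateRepresentation` — the Galois action on `V_ℓ(E_ns(F̄))` is jointly
  continuous (so the `ℓ`-adic representation `rationalTateGaloisRepOf (geomPoints W_a) ℓ h` of
  `HasseWeilAbelian` exists for the node);
* `tateRepresentation_eq_one_of_smul_sqrt_eq` / `…_eq_neg_one_of_smul_sqrt_eq_neg` and their
  rational versions — an element of `Γ_F` fixing the `ℓ`-power roots of unity acts on `T_ℓ`, `V_ℓ`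
  as `+1` or `-1` according as it fixes or negates `√a`: **`V_ℓ(E_ns) ≅ ℚ_ℓ(1) ⊗ χ_a`**
  (Silverman, *AEC*, Exercise 3.5);
* over a number field `K` with `a ∈ 𝓞 K` (written `algebraMap (𝓞 K) K b = a`):
  `smul_sqrt_eq_of_mem_inertia` (inertia at a place `v ∤ 4a` fixes `√a` — `K(√a)/K` is
  unramified away from `4a`),
  `rationalTateRepresentation_eq_one_of_mem_inertia` (**`V_ℓ(E_ns)` is unramified at every
  `v ∤ 4aℓ`**, with the tree's `smul_eq_self_of_mem_inertia_of_pow_prime_pow_eq_one` for the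
  roots of unity) and `rationalTateRepresentation_eq_neg_one_of_mem_inertia` (an inertia element
  at `v ∤ ℓ` negating `√a` acts as `-1`).

These feed the computation of the Artin conductor of `V_ℓ(E_ns)` for a non-split node over `ℚ`,
the counterexample to the singular clause of the conductor schemas of `BSDConductor`
(`BSDConductorSingularProofs`).  Theorems only; nothing here uses an undischarged named fact.

## References

* J. H. Silverman, *The Arithmetic of Elliptic Curves*, 2nd ed., GTM 106 (2009), Prop. III.2.5
  and Exercise 3.5. [SilvermanAEC2009]
* J. H. Silverman, *Advanced Topics in the Arithmetic of Elliptic Curves*, GTM 151 (1994), proof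
  of Thm. IV.10.2(a), PDF p. 359 (`V_ℓ(k̄^*) ≅ ℚ_ℓ`). [SilvermanATAEC1994]
* J.-P. Serre, *Abelian ℓ-adic representations and elliptic curves* (1968), Ch. I §1.2 (the
  cyclotomic character is unramified away from `ℓ`). [SerreAbelianLadic1968]

## Design

`noncomputable section`, `open scoped Classical`, one universe `u`; theorems in
`namespace WeierstrassCurve.nodalCubic` (dot-notation extensions, as in `NonsplitNode`).  The
representation-level statements are about the tree's `tateRepresentation` /
`rationalTateRepresentation` (`TateModule`), i.e. literally the representations underlying
`rationalTateGaloisRepOf` of `HasseWeilAbelian`.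
-/

noncomputable section

open scoped Classical AddSubgroup NumberField

universe u

/-! ### The `ℓ`-adic Tate module of the node -/

namespace WeierstrassCurve

namespace nodalCubic

open Literature.NumberTheory.EllipticCurves Literature.NumberTheory.GaloisRepresentations Field
  IsDedekindDomain

section TateModule

variable {F : Type u} [Field F] {a : F} (ℓ : ℕ) [Fact ℓ.Prime]

/-- `E_ns(F̄)[ℓ]` is finite (`2a ≠ 0`). Silverman, *AEC*, Prop. III.2.5(a).
[cite: SilvermanAEC2009, Prop. III.2.5(a)] -/
theorem finite_torsionBy_prime (ha : 2 * a ≠ 0) :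
    Finite ((geomPoints (nodalCubic a))[(ℓ : ℕ)]) :=
  finite_torsionBy ha (Fact.out : ℓ.Prime).pos

/-- `T_ℓ(E_ns(F̄))` is a finitely generated `ℤ_ℓ`-module (`2a ≠ 0`).
Silverman, *AEC*, III.7.1 with Prop. III.2.5(a). [folklore] -/
theorem module_finite_tateModule (ha : 2 * a ≠ 0) :
    Module.Finite ℤ_[ℓ] (TateModule (geomPoints (nodalCubic a)) ℓ) :=
  TateModule.finite_of_finite_torsionBy (finite_torsionBy_prime ℓ ha)

/-- `V_ℓ(E_ns(F̄))` is finite-dimensional over `ℚ_ℓ` (`2a ≠ 0`). [folklore] -/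
theorem module_finite_rationalTateModule (ha : 2 * a ≠ 0) :
    Module.Finite ℚ_[ℓ] (RationalTateModule (geomPoints (nodalCubic a)) ℓ) :=
  RationalTateModule.finite_of_finite_torsionBy (finite_torsionBy_prime ℓ ha)

/-- **`rank T_ℓ(E_ns(F̄)) = 1`** for the node with `2a ≠ 0` and `ℓ ≠ char F`: the node map
induces `T_ℓ(E_ns(F̄)) ≅ T_ℓ(F̄ˣ) ≅ ℤ_ℓ` (Silverman, *ATAEC*, proof of Thm. IV.10.2(a), PDF
p. 359: "`V_ℓ(k̄^*) ≅ ℚ_ℓ`"; the tree's `finrank_tateModule_additive_units`).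
[cite: SilvermanATAEC1994, proof of Thm. IV.10.2(a), PDF p. 359] -/
theorem finrank_tateModule_eq_one (ha : 2 * a ≠ 0) (hℓ : (ℓ : F) ≠ 0) :
    Module.finrank ℤ_[ℓ] (TateModule (geomPoints (nodalCubic a)) ℓ) = 1 := by
  have hℓ' : (ℓ : AlgebraicClosure F) ≠ 0 := fun h ↦ hℓ <|
    (algebraMap F (AlgebraicClosure F)).injective (by rw [map_natCast, h, map_zero])
  have hbij := TateModule.map_bijective_of_injective_of_forall_mem_range (p := ℓ) (nodeMap a)
    (nodeMap_injective ha) fun b _ _ ↦ (nodeMap_bijective ha).2 b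
  rw [(LinearEquiv.ofBijective _ hbij).finrank_eq, finrank_tateModule_additive_units ℓ hℓ']

/-- **`dim V_ℓ(E_ns(F̄)) = 1`** for the node with `2a ≠ 0` and `ℓ ≠ char F`.
[cite: SilvermanATAEC1994, proof of Thm. IV.10.2(a), PDF p. 359] -/
theorem finrank_rationalTateModule_eq_one (ha : 2 * a ≠ 0) (hℓ : (ℓ : F) ≠ 0) :
    Module.finrank ℚ_[ℓ] (RationalTateModule (geomPoints (nodalCubic a)) ℓ) = 1 := by
  rw [RationalTateModule.finrank_eq_of_finite_torsionBy (finite_torsionBy_prime ℓ ha),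
    finrank_tateModule_eq_one ℓ ha hℓ]

/-- The Galois action on `V_ℓ(E_ns(F̄))` is jointly continuous (`E_ns(F̄)` is a discrete
`Γ_F`-module, `continuousSMul_geomPoints'`, and `T_ℓ` is finitely generated,
`Literature.NumberTheory.EllipticCurves.continuous_rationalTateRepresentation`). [folklore] -/
theorem continuous_rationalTateRepresentation (ha : 2 * a ≠ 0) :
    Continuous fun x : absoluteGaloisGroup F × RationalTateModule (geomPoints (nodalCubic a)) ℓ ↦
      rationalTateRepresentation (absoluteGaloisGroup F) (geomPoints (nodalCubic a)) ℓ x.1 x.2 := by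
  haveI := continuousSMul_geomPoints' (nodalCubic a)
  haveI := module_finite_tateModule ℓ ha
  exact Literature.NumberTheory.EllipticCurves.continuous_rationalTateRepresentation ℓ

/-- **Trivial action on `T_ℓ`.**  An element `σ ∈ Γ_F` fixing `√a` and the `ℓ`-power roots of
unity acts as the identity on `T_ℓ(E_ns(F̄))` (componentwise `smul_eq_self_of_smul_sqrt_eq`).
Silverman, *AEC*, Exercise 3.5. [cite: SilvermanAEC2009, Exercise 3.5] -/
theorem tateRepresentation_eq_one_of_smul_sqrt_eq (ha : 2 * a ≠ 0) {σ : absoluteGaloisGroup F}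
    (hσ : σ • sqrt a = sqrt a)
    (hroots : ∀ (n : ℕ) (t : AlgebraicClosure F), t ^ ℓ ^ n = 1 → σ • t = t) :
    tateRepresentation (absoluteGaloisGroup F) (geomPoints (nodalCubic a)) ℓ σ = 1 := by
  refine LinearMap.ext fun x ↦ TateModule.ext fun n ↦ ?_
  rw [tateRepresentation_apply_apply, TateModule.proj_smul_of_distribMulAction,
    Module.End.one_apply]
  exact smul_eq_self_of_smul_sqrt_eq ha hσ (hroots n) (TateModule.pow_smul_proj n x)

/-- **Trivial action on `V_ℓ`** (base change of `tateRepresentation_eq_one_of_smul_sqrt_eq`).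
[cite: SilvermanAEC2009, Exercise 3.5] -/
theorem rationalTateRepresentation_eq_one_of_smul_sqrt_eq (ha : 2 * a ≠ 0)
    {σ : absoluteGaloisGroup F} (hσ : σ • sqrt a = sqrt a)
    (hroots : ∀ (n : ℕ) (t : AlgebraicClosure F), t ^ ℓ ^ n = 1 → σ • t = t) :
    rationalTateRepresentation (absoluteGaloisGroup F) (geomPoints (nodalCubic a)) ℓ σ = 1 := by
  change Module.End.baseChangeHom ℤ_[ℓ] ℚ_[ℓ] _
    (tateRepresentation (absoluteGaloisGroup F) (geomPoints (nodalCubic a)) ℓ σ) = 1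
  rw [tateRepresentation_eq_one_of_smul_sqrt_eq ℓ ha hσ hroots, map_one]

/-- **The twisting element acts as `-1` on `T_ℓ`.**  An element `σ ∈ Γ_F` with `σ √a = -√a`
fixing the `ℓ`-power roots of unity acts as `-1` on `T_ℓ(E_ns(F̄))` (componentwise
`smul_eq_neg_of_smul_sqrt_eq_neg`): `T_ℓ(E_ns) ≅ ℤ_ℓ(1) ⊗ χ_a`.  Silverman, *AEC*, Exercise 3.5.
[cite: SilvermanAEC2009, Exercise 3.5] -/
theorem tateRepresentation_eq_neg_one_of_smul_sqrt_eq_neg (ha : 2 * a ≠ 0)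
    {σ : absoluteGaloisGroup F} (hσ : σ • sqrt a = -sqrt a)
    (hroots : ∀ (n : ℕ) (t : AlgebraicClosure F), t ^ ℓ ^ n = 1 → σ • t = t) :
    tateRepresentation (absoluteGaloisGroup F) (geomPoints (nodalCubic a)) ℓ σ = -1 := by
  refine LinearMap.ext fun x ↦ TateModule.ext fun n ↦ ?_
  rw [tateRepresentation_apply_apply, TateModule.proj_smul_of_distribMulAction,
    LinearMap.neg_apply, Module.End.one_apply, map_neg]
  exact smul_eq_neg_of_smul_sqrt_eq_neg ha hσ (hroots n) (TateModule.pow_smul_proj n x)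

/-- **The twisting element acts as `-1` on `V_ℓ`** (base change). [cite: SilvermanAEC2009, Exercise 3.5] -/
theorem rationalTateRepresentation_eq_neg_one_of_smul_sqrt_eq_neg (ha : 2 * a ≠ 0)
    {σ : absoluteGaloisGroup F} (hσ : σ • sqrt a = -sqrt a)
    (hroots : ∀ (n : ℕ) (t : AlgebraicClosure F), t ^ ℓ ^ n = 1 → σ • t = t) :
    rationalTateRepresentation (absoluteGaloisGroup F) (geomPoints (nodalCubic a)) ℓ σ = -1 := by
  change Module.End.baseChangeHom ℤ_[ℓ] ℚ_[ℓ] _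
    (tateRepresentation (absoluteGaloisGroup F) (geomPoints (nodalCubic a)) ℓ σ) = -1
  rw [tateRepresentation_eq_neg_one_of_smul_sqrt_eq_neg ℓ ha hσ hroots, map_neg, map_one]

end TateModule

/-! ### Over a number field: inertia groups -/

section NumberField

variable {K : Type u} [Field K] [NumberField K] {a : K} {b : 𝓞 K} (hb : algebraMap (𝓞 K) K b = a)
  (ℓ : ℕ) [Fact ℓ.Prime]
include hb

omit [NumberField K] in
/-- **Inertia away from `4a` fixes `√a`.**  For `a ∈ 𝓞 K` (written `a = b` with `b : 𝓞 K`), a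
finite place `v` with `4a ∉ v`, a prime `𝔓` of `\bar ℤ_K` above `v` and `σ ∈ I_𝔓`: `σ √a = √a`.
(`σ √a ≡ √a (mod 𝔓)` and `σ √a = ± √a`; if `σ √a = -√a` then `2√a ∈ 𝔓`, `4a ∈ 𝔓 ∩ 𝓞 K = v`.)
This is the unramifiedness of `K(√a)/K` away from `4a`; Neukirch, *Algebraic Number Theory*,
Ch. I §8. [folklore] -/
theorem smul_sqrt_eq_of_mem_inertia {v : HeightOneSpectrum (𝓞 K)} (hv : 4 * b ∉ v.asIdeal)
    {𝔓 : Ideal (absIntegers (𝓞 K) K)} (h𝔓 : 𝔓 ∈ v.primesAbove)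
    {σ : absoluteGaloisGroup K} (hσ : σ ∈ 𝔓.inertia (absoluteGaloisGroup K)) :
    σ • sqrt a = sqrt a := by
  haveI : 𝔓.IsPrime := h𝔓.1
  have hsq : sqrt a ^ 2 = algebraMap (𝓞 K) (AlgebraicClosure K) b := by
    rw [sqrt_sq, IsScalarTower.algebraMap_apply (𝓞 K) K (AlgebraicClosure K), hb]
  have hint : _root_.IsIntegral (𝓞 K) (sqrt a) :=
    IsIntegral.of_pow two_pos (by rw [hsq]; exact isIntegral_algebraMap)
  set x : absIntegers (𝓞 K) K := ⟨sqrt a, hint⟩ with hx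
  rcases smul_sqrt_eq_or (a := a) σ with h | h
  · exact h
  · exfalso
    apply hv
    have hmem : σ • x - x ∈ 𝔓 := hσ x
    have h2 : (σ • x - x : absIntegers (𝓞 K) K) = -(2 * x) := Subtype.ext (by
      rw [AddSubgroupClass.coe_sub, integralClosure.coe_smul]
      change σ • sqrt a - sqrt a = _
      rw [h]
      change _ = -(2 * sqrt a)
      ring)
    rw [h2, neg_mem_iff] at hmem
    have h4 : (2 * x) * (2 * x) = algebraMap (𝓞 K) (absIntegers (𝓞 K) K) (4 * b) :=
      Subtype.ext (by
        rw [map_mul]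
        change (2 * sqrt a) * (2 * sqrt a) = _
        rw [show (2 * sqrt a) * (2 * sqrt a) = 4 * sqrt a ^ 2 by ring, hsq]
        change _ = ((algebraMap (𝓞 K) (absIntegers (𝓞 K) K) 4 : absIntegers (𝓞 K) K) :
          AlgebraicClosure K) * (algebraMap (𝓞 K) (absIntegers (𝓞 K) K) b : AlgebraicClosure K)
        rw [map_ofNat]
        rfl)
    have hmem4 : algebraMap (𝓞 K) (absIntegers (𝓞 K) K) (4 * b) ∈ 𝔓 := by
      rw [← h4]; exact 𝔓.mul_mem_left _ hmem
    rw [h𝔓.2.over, Ideal.under_def, Ideal.mem_comap]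
    exact hmem4

/-- **`V_ℓ(E_ns)` is unramified away from `4aℓ`.**  For the node `y² = x³ + a x²` over a number
field `K` (`a ∈ 𝓞 K`, `2a ≠ 0`), a finite place `v` with `4a ∉ v` and `ℓ ∉ v`, a prime `𝔓 ∣ v`
of `\bar ℤ_K` and `σ ∈ I_𝔓`, `σ` acts trivially on `V_ℓ(E_ns(K̄))`: it fixes `√a`
(`smul_sqrt_eq_of_mem_inertia`) and the `ℓ`-power roots of unity
(`smul_eq_self_of_mem_inertia_of_pow_prime_pow_eq_one`).  Silverman, *AEC*, Exercise 3.5 with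
Serre, *Abelian ℓ-adic representations*, I §1.2. [cite: SilvermanAEC2009, Exercise 3.5] -/
theorem rationalTateRepresentation_eq_one_of_mem_inertia (ha : 2 * a ≠ 0)
    {v : HeightOneSpectrum (𝓞 K)} (hv : 4 * b ∉ v.asIdeal) (hvℓ : (ℓ : 𝓞 K) ∉ v.asIdeal)
    {𝔓 : Ideal (absIntegers (𝓞 K) K)} (h𝔓 : 𝔓 ∈ v.primesAbove)
    {σ : absoluteGaloisGroup K} (hσ : σ ∈ 𝔓.inertia (absoluteGaloisGroup K)) :
    rationalTateRepresentation (absoluteGaloisGroup K) (geomPoints (nodalCubic a)) ℓ σ = 1 :=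
  rationalTateRepresentation_eq_one_of_smul_sqrt_eq ℓ ha (smul_sqrt_eq_of_mem_inertia hb hv h𝔓 hσ)
    fun _ _ ht ↦ smul_eq_self_of_mem_inertia_of_pow_prime_pow_eq_one hvℓ h𝔓 hσ ht

omit hb in
/-- **An inertia element moving `√a` acts as `-1`.**  For a finite place `v ∤ ℓ`, a prime `𝔓 ∣ v`
and `σ ∈ I_𝔓` with `σ √a = -√a` (which happens at the places ramified in `K(√a)`), `σ` acts as
`-1` on `V_ℓ(E_ns(K̄))`. Silverman, *AEC*, Exercise 3.5. [cite: SilvermanAEC2009, Exercise 3.5] -/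
theorem rationalTateRepresentation_eq_neg_one_of_mem_inertia (ha : 2 * a ≠ 0)
    {v : HeightOneSpectrum (𝓞 K)} (hvℓ : (ℓ : 𝓞 K) ∉ v.asIdeal)
    {𝔓 : Ideal (absIntegers (𝓞 K) K)} (h𝔓 : 𝔓 ∈ v.primesAbove)
    {σ : absoluteGaloisGroup K} (hσ : σ ∈ 𝔓.inertia (absoluteGaloisGroup K))
    (hσa : σ • sqrt a = -sqrt a) :
    rationalTateRepresentation (absoluteGaloisGroup K) (geomPoints (nodalCubic a)) ℓ σ = -1 :=
  rationalTateRepresentation_eq_neg_one_of_smul_sqrt_eq_neg ℓ ha hσa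
    fun _ _ ht ↦ smul_eq_self_of_mem_inertia_of_pow_prime_pow_eq_one hvℓ h𝔓 hσ ht

end NumberField

end nodalCubic

end WeierstrassCurve

end
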